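import Literature.AlgebraicGeometry.HodgeTheory.FlatSpanOfJetSpan
import Summits.HodgeConjecture.HodgeConjecture.Theorems.Q8SymplecticPowersTranscendentalIrreducibleOfFlatSpan
import HarnessLib

/-!
# Route `Q8SymplecticPowers`, crux K1Q (stmt-HodgeConjecture-24190), stub S4 `stub_transcendentalQuaternionicPartQ`:
# all six conjuncts at a member from a JET-SPAN certificate

Prover seat `hodge-nonav-20241-p1` (g22); helper `--supports stmt-HodgeConjecture-24190` (closes no registered
stub). Composition of the tree's `flatSpan_of_jetSpan` (`Literature/AlgebraicGeometry/HodgeTheory/FlatSpanOfJetSpan`: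
(FS)_s from a finite jet-span statement at one member) with `transcendentalQuaternionicPart_at_member_of_flatSpan`
(`Q8SymplecticPowersTranscendentalIrreducibleOfFlatSpan`: the six S4-v6 conjuncts at `s` from (FS)_s, FACT B,
`A⁴ = 1` and three Hodge counts). RESULT `transcendentalQuaternionicPart_at_member_of_jetSpan`, in the VERBATIM
`let`-currency of the registered S4 (`Xs hXs A Qf Γ N Mv Miv`, `M := ker(A_ℂ − i)`): given FACT B, `A ^ 4 = 1`,
(o)_s, (o′)_s, `6 ≤ finrank M`, `finrank (M ⊓ F²) ≤ 1`, a chart `ψ` of the base with an open `W₀ ∋ s` in its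
source, a map `ω : ℂ^d → ℂ ⊗_ℚ H²(X_s; ℚ)` with `ω (ψ t) ∈ M ∩ F²(X_t)` (pulled back to `s` by rational transport)
for all members `t ∈ W₀` reached inside `W₀`, and the JET-SPAN statement «every functional `φ` with
`D^i(φ ∘ ω)(ψ s) = 0` for `i ≤ r` kills `M`» (dual form of «the `≤ r`-jet of `ω` at `s` spans `M`»), the conclusion
of S4 holds at `s`: `(o) ∧ (o′) ∧ (i) ∧ (ii) ∧ ((iii)) ∧ (iv)`. This is the shape in which an exact computation at
ONE rational member (Griffiths residues and their derivatives in the moduli, rank `8 = dim M` at `e = 4`; the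
cell's «JetSpan₄», pending the directors' Q-COMP ruling) enters the line. HONEST FRAMING: conditional helper;
S4 (all `e`, all families, all `s`), K1Q, HC are NOT proved.
-/

noncomputable section

set_option linter.dupNamespace false

namespace Summit.HodgeConjecture.HodgeConjecture.Theorems.Q8SymplecticPowersTranscendentalPartOfJetSpan

open CategoryTheory CategoryTheory.Limits AlgebraicGeometry
open scoped TensorProduct
open Literature.AlgebraicTopology.SingularHomology
open Literature.AlgebraicGeometry.Motives Literature.AlgebraicGeometry.HodgeTheory
open Literature.AlgebraicGeometry.HodgeTheory.BettiUniverse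
open Summit.HodgeConjecture.HodgeConjecture.Theorems.Q8SymplecticPowersTranscendentalIrreducibleOfFlatSpan

variable {𝒳 S : SchemeOver ℂ}

/-- **S4 at a member from a jet-span certificate** (verbatim S4-v6 `let`-currency; see the module docstring).
[cite: Deligne1987, §1.12–1.13 (p. 10–11)] [cite: VoisinHodgeI2002, §9.3.1 Prop. 9.20, §10.2.1 Thm. 10.3 and §10.2.3] -/
theorem transcendentalQuaternionicPart_at_member_of_jetSpan
    (hDelB : deligne1987_monodromy_directSum_irreducible_subvariations)
    (π : 𝒳 ⟶ S) (d : ℕ) (hπ : IsSmoothProjectiveFamily π 2)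
    (h𝒳 : IsQuasiProjectiveOver 𝒳) (hS : IsQuasiProjectiveOver S)
    [AlgebraicGeometry.SmoothOfRelativeDimension d S.hom]
    (hU : IsCohomologicallyLocallyTrivialOn π (Set.univ : Set (ComplexPoints S)))
    (τ : 𝒳 ⟶ 𝒳) (hτπ : τ ≫ π = π) (s : ComplexPoints S)
    (ψ : OpenPartialHomeomorph (Set.univ : Set (ComplexPoints S)) (Fin d → ℂ))
    (W₀ : Set (Set.univ : Set (ComplexPoints S))) (hW₀o : IsOpen W₀)
    (hsW₀ : (⟨s, Set.mem_univ s⟩ : (Set.univ : Set (ComplexPoints S))) ∈ W₀) (hW₀ψ : W₀ ⊆ ψ.source)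
    (ω : (Fin d → ℂ) → ℂ ⊗[ℚ] bettiCohomology (fiberOver π s) 2) (r : ℕ) :
    let Xs := fiberOver π s
    let hXs : IsSmoothProjective 2 Xs := hπ.isSmoothProjective s
    let A : bettiCohomology Xs 2 →ₗ[ℚ] bettiCohomology Xs 2 := pull (fiberOverEnd π τ hτπ s) 2
    let Qf : LinearMap.BilinForm ℚ (bettiCohomology Xs 2) := LinearMap.compr₂ (cup Xs 2 2) (tr hXs (2 + 2))
    let Γ := ratMonodromyGroup π 2 hU ⟨s, Set.mem_univ s⟩
    let N : Submodule ℚ (bettiCohomology Xs 2) := Submodule.span ℚ {x | ∃ Γ' : Subgroup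
      (bettiCohomology Xs 2 ≃ₗ[ℚ] bettiCohomology Xs 2), Γ' ≤ Γ ∧ (Γ'.subgroupOf Γ).FiniteIndex ∧
        ∀ γ ∈ Γ', γ x = x}
    let Mv : Submodule ℚ (bettiCohomology Xs 2) := Module.End.eigenspace (A ^ 2) (-1) ⊓ Qf.orthogonal N
    let Miv : Submodule ℂ (TensorProduct ℚ ℂ (bettiCohomology Xs 2)) :=
      Mv.baseChange ℂ ⊓ Module.End.eigenspace (A.baseChange ℂ) Complex.I
    let M : Submodule ℂ (TensorProduct ℚ ℂ (bettiCohomology Xs 2)) :=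
      Module.End.eigenspace (A.baseChange ℂ) Complex.I
    A ^ 4 = 1 →
    Module.finrank ℂ ↥(Module.End.eigenspace ((A ^ 2).baseChange ℂ) 1 ⊓
      (hodge exists_isReal_hodgeModel_holds hXs 2).piece 2 0) = 0 →
    0 < Module.finrank ℂ ↥(Module.End.eigenspace ((A ^ 2).baseChange ℂ) (-1) ⊓
      (hodge exists_isReal_hodgeModel_holds hXs 2).piece 2 0) →
    6 ≤ Module.finrank ℂ ↥M →
    Module.finrank ℂ ↥(M ⊓ (hodge exists_isReal_hodgeModel_holds hXs 2).F 2) ≤ 1 →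
    (∀ t ∈ W₀, ∀ (ε : Path (⟨s, Set.mem_univ s⟩ : (Set.univ : Set (ComplexPoints S))) t), (∀ r', ε r' ∈ W₀) →
      ∀ (T : bettiCohomology Xs 2 ≃ₗ[ℚ] bettiCohomology (fiberOver π t.1) 2),
        (∀ v, ofRatClass _ 2 (T v) = transportFun π 2 hU ⟦ε⟧ (ofRatClass _ 2 v)) →
        ω (ψ t) ∈ M ⊓ ((hodge exists_isReal_hodgeModel_holds (hπ.isSmoothProjective t.1) 2).comapEquiv T).F 2) →
    (∀ φ : Module.Dual ℂ (TensorProduct ℚ ℂ (bettiCohomology Xs 2)),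
      (∀ i ≤ r, iteratedFDeriv ℂ i (fun z ↦ φ (ω z)) (ψ ⟨s, Set.mem_univ s⟩) = 0) → ∀ m ∈ M, φ m = 0) →
    Module.finrank ℂ ↥(Module.End.eigenspace ((A ^ 2).baseChange ℂ) 1 ⊓
        (hodge exists_isReal_hodgeModel_holds hXs 2).piece 2 0) = 0 ∧
      0 < Module.finrank ℂ ↥(Module.End.eigenspace ((A ^ 2).baseChange ℂ) (-1) ⊓
        (hodge exists_isReal_hodgeModel_holds hXs 2).piece 2 0) ∧
      (N.baseChange ℂ ⊓ (hodge exists_isReal_hodgeModel_holds hXs 2).piece 2 0 = ⊥) ∧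
      6 ≤ Module.finrank ℂ ↥Miv ∧
      (∀ Γ' : Subgroup (bettiCohomology Xs 2 ≃ₗ[ℚ] bettiCohomology Xs 2), Γ' ≤ Γ →
        (Γ'.subgroupOf Γ).FiniteIndex → ∀ F : Submodule ℂ (TensorProduct ℚ ℂ (bettiCohomology Xs 2)),
          F ≤ Miv → (∀ γ ∈ Γ', ∀ x ∈ F, (γ.toLinearMap.baseChange ℂ) x ∈ F) → F = ⊥ ∨ F = Miv) ∧
      N ≤ Module.End.eigenspace (A ^ 2) 1 := by
  intro Xs hXs A Qf Γ N Mv Miv M hA4 ho ho' h6 ha hω hjet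
  -- the real Hodge models of the fibres (`(Am t).hodgeStructure … 2 = hodge … 2` definitionally)
  let Am : ∀ t : ComplexPoints S, HodgeModel 2 (fiberOver π t) := fun t ↦
    realHodgeModel exists_isReal_hodgeModel_holds (hπ.isSmoothProjective t)
  have hAm : ∀ t, (Am t).IsHodgeSymmetric := fun t ↦
    realHodgeModel_isHodgeSymmetric exists_isReal_hodgeModel_holds (hπ.isSmoothProjective t)
  have hFS := flatSpan_of_jetSpan π 2 2 d hπ hU Am hAm ⟨s, Set.mem_univ s⟩ M 2 ψ W₀ hW₀o hsW₀ hW₀ψ ω hω r hjet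
  exact transcendentalQuaternionicPart_at_member_of_flatSpan hDelB π d hπ h𝒳 hS hU τ hτπ s hA4 ho ho' h6 ha hFS

end Summit.HodgeConjecture.HodgeConjecture.Theorems.Q8SymplecticPowersTranscendentalPartOfJetSpan

end
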